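import Summits.ABC.StewartYu.PadicTwistPMAssembly
import Summits.ABC.StewartYu.PadicTwistPMHalfProvider
import Summits.ABC.StewartYu.PadicTwistPMAdapters
import Summits.ABC.StewartYu.PadicTwistPack
import Summits.ABC.StewartYu.PadicW80SizesLPM
import Summits.ABC.StewartYu.DescentIntegralityQ
import HarnessLib

/-!
# Cell abc-stewartyu, provider B (xix): the parameter pack of the ± machine at p1's
# `(log p)`-normalised record with the SHARP half-point sizes — ALL inputs of `main_pm` discharged

`Summits/ABC/StewartYu/PadicTwistPMPack.lean` — cell `abc-stewartyu` (seat p1-g5 executing p3-g2's brief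
HANDOFF §p3 (5″) under the planner's contingency 2026-08-26 10:32Z; crux `W80OneModFour` stmt-ABC-19487;
one `ℤ`-valued and one structure-valued `def` + theorems, no named fact).  TWIN of p2's
`PadicTwistPack.lean` (provider A, crux 19485) for the ± invariant, on the SAME record `PadicW80ParL S.d`
(`ℓ = log p`, class price `Mcl = G`, ANY twist order `G`):

* the inner steps are shared: `kSizes_of_hypPM` (p2's junction read on the ± invariant — only the bound
  `|p(u)| ≤ P` is used), p2's `kFinal_of_log_ineq` with p1's `kstep_ineq_one/two`, `logDM_le_budget`;
* Siegel on a class with the SHARP bound `AmaxPM = 𝔔²¹E(2)` (`siegel_of_hyp_pm`, `PintPM = ⌈#box₀·AmaxPM⌉ ≤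
  PrVPM ≤ PrV`), so the landed coarse k-step sizes `Mmax_k = 𝔅·PrV·Dmax_k` still apply;
* the half step via p3's `halfStepPM_of_numerics` with `D(s,τ) = Dhalf♭ ≤ DmaxHPM = 𝔔¹⁶E(2)`,
  `Mb = max(MmaxHPM, ·)`, and the half-point inequality at Liouville exponent `2^{d+2}`
  (`hFinalHalfPM_of_log_ineq`) fed by the LANDED `halfstep_ineq_one/two` through p1's budget
  `bhalf_le_budget_pm` (same right-hand side `(7/16)·2ᵈ𝔘`) and `threshold_antitone`;
* the endgame by `endgamePM_of_numbers` + p1's `endgame_numbers`;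
* **`paramPackPMOf : S.ParamPackPM P.Uℓ`**, `norm_Λ₀_gt_pm : e^{−U} < ‖Λ₀‖_p`.

## References
* [Yu1990] K. Yu, Compositio Math. 74 (1990), §2 Proposition 2.1, §2.4 Lemmas 2.4–2.5, (2.30)–(2.33).
* [Waldschmidt1980] M. Waldschmidt, Acta Arith. 37 (1980), §§3.2–3.5.
-/

noncomputable section

open Finset
open Literature.NumberTheory.Transcendental
open Literature.NumberTheory.Transcendental.CW77 (heightProd hgt)
open Literature.NumberTheory.Transcendental.CW77.Setup (Idx Tau tauNorm tauSet)
open Literature.NumberTheory.Transcendental.PadicCW77 (condExp)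

namespace Summit.ABC.StewartYu

namespace TwistSetup

open PadicW80Par (cLp')

variable {p : ℕ} [Fact p.Prime] (S : TwistSetup p) {h Lb : ℕ}

/-! ### The half-point inequality at Liouville exponent `2^{d+2}` in logarithmic form -/

/-- **The provider-B half-point inequality from two inequalities between logarithms, `log p` SYMBOLIC**:
with `kpts = 2^{d+J} S₀/2` and `B = 2^{d+2}·log(4·DmaxH²·MmaxH·(∏H(allᵢ))³) − log DmaxH`, if
`‖Λ₀‖_p ≤ e^{−U}`, (1) `(⌊hLb/(p−1)⌋ + ⌊(t−1)/(p−1)⌋ + condExp)·log p + B < U` and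
(2) `hLb·log p + B < (kpts·t/2)·log p`, then the Schwarz bound at the half points is below the
`ℂ_p`-Liouville threshold `DmaxH/(4·DmaxH²·MmaxH·(∏H)³)^{2^{d+2}}` of p3's `halfStep_pm_of` (one extra
root `ι`). Twin of p2's `hFinalHalf_of_log_ineq` with `2^{d+1} ↦ 2^{d+2}`. [cite: Yu1990, §2.4 Lemma 2.4] -/
theorem hFinalHalfPM_of_log_ineq {U : ℝ} (J S₀ t : ℕ) {DmaxH MmaxH : ℝ}
    (hΛ : ‖S.Λ₀‖ ≤ Real.exp (-U)) (hD : 0 < DmaxH) (hM : 0 < MmaxH)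
    (h1 : ((h * Lb / (p - 1) + (t - 1) / (p - 1) + condExp p (2 ^ (S.d + J) * S₀ / 2) t : ℕ) : ℝ) *
          Real.log p +
        ((2 : ℝ) ^ (S.d + 2) * Real.log (4 * DmaxH ^ 2 * MmaxH * heightProd S.toQ.all ^ 3) -
          Real.log DmaxH) < U)
    (h2 : ((h * Lb : ℕ) : ℝ) * Real.log p +
        ((2 : ℝ) ^ (S.d + 2) * Real.log (4 * DmaxH ^ 2 * MmaxH * heightProd S.toQ.all ^ 3) -
          Real.log DmaxH) <
        (((2 ^ (S.d + J) * S₀ / 2) * t : ℕ) : ℝ) / 2 * Real.log p) :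
    max ((p : ℝ) ^ (h * Lb / (p - 1)) * ‖S.Λ₀‖ * (p : ℝ) ^ ((t - 1) / (p - 1)) *
          (p : ℝ) ^ condExp p (2 ^ (S.d + J) * S₀ / 2) t)
        ((p : ℝ) ^ (h * Lb) / Real.sqrt p ^ ((2 ^ (S.d + J) * S₀ / 2) * t)) <
      DmaxH / (4 * DmaxH ^ 2 * MmaxH * heightProd S.toQ.all ^ 3) ^ (2 ^ (S.d + 1 + 1)) := by
  have hH : 1 ≤ heightProd S.toQ.all := CW77.one_le_heightProd _
  have hQ : 0 < 4 * DmaxH ^ 2 * MmaxH * heightProd S.toQ.all ^ 3 := by positivity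
  have e22 : S.d + 1 + 1 = S.d + 2 := rfl
  have hrhs : DmaxH / (4 * DmaxH ^ 2 * MmaxH * heightProd S.toQ.all ^ 3) ^ (2 ^ (S.d + 1 + 1)) =
      Real.exp (Real.log DmaxH -
        (2 : ℝ) ^ (S.d + 2) * Real.log (4 * DmaxH ^ 2 * MmaxH * heightProd S.toQ.all ^ 3)) := by
    have hc : (2 : ℝ) ^ (S.d + 2) * Real.log (4 * DmaxH ^ 2 * MmaxH * heightProd S.toQ.all ^ 3) =
        Real.log ((4 * DmaxH ^ 2 * MmaxH * heightProd S.toQ.all ^ 3) ^ (2 ^ (S.d + 1 + 1))) := by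
      rw [Real.log_pow, e22]; push_cast; ring
    rw [hc, Real.exp_sub, Real.exp_log hD, Real.exp_log (pow_pos hQ _)]
  rw [hrhs]
  refine max_lt ?_ ?_
  · rcases (norm_nonneg S.Λ₀).eq_or_lt with h0 | hpos
    · rw [← h0]; simp [Real.exp_pos]
    · have e1 : (p : ℝ) ^ (h * Lb / (p - 1)) * ‖S.Λ₀‖ * (p : ℝ) ^ ((t - 1) / (p - 1)) *
          (p : ℝ) ^ condExp p (2 ^ (S.d + J) * S₀ / 2) t =
          Real.exp (((h * Lb / (p - 1) : ℕ) : ℝ) * Real.log p + Real.log ‖S.Λ₀‖ +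
            (((t - 1) / (p - 1) : ℕ) : ℝ) * Real.log p +
            (condExp p (2 ^ (S.d + J) * S₀ / 2) t : ℝ) * Real.log p) := by
        rw [S.natPow_eq_exp, S.natPow_eq_exp, S.natPow_eq_exp, ← Real.exp_log hpos]
        simp only [← Real.exp_add, Real.log_exp]
      rw [e1, Real.exp_lt_exp]
      have hlog : Real.log ‖S.Λ₀‖ ≤ -U := by
        have := Real.log_le_log hpos hΛ; rwa [Real.log_exp] at this
      push_cast at h1 ⊢
      linarith
  · have e2 : (p : ℝ) ^ (h * Lb) / Real.sqrt p ^ ((2 ^ (S.d + J) * S₀ / 2) * t) =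
        Real.exp (((h * Lb : ℕ) : ℝ) * Real.log p -
          (((2 ^ (S.d + J) * S₀ / 2) * t : ℕ) : ℝ) / 2 * Real.log p) := by
      rw [S.natPow_eq_exp, S.sqrt_pow_eq_exp, ← Real.exp_sub]
    rw [e2, Real.exp_lt_exp]
    linarith

/-! ### The junctions at p1's record, ± form -/

variable {S}
variable {P : PadicW80ParL S.d} (hy : S.toQ.flat.SizeHyp P.V P.Vθ P.W)
include hy

/-- **The archimedean sizes of the inner steps on the ± invariant** (p2's `kSizes_of_hyp` uses only the
bound `|p(u)| ≤ Pint ≤ PrV` of the invariant, so it holds verbatim for `InvPM`). [folklore] -/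
theorem kSizes_of_hypPM {J : ℕ} (hJ : J < P.J₀ℓ) (t : ℕ) {Pint : ℤ} (hPint : (Pint : ℝ) ≤ P.PrVℓ)
    {pv : Idx S.d P.hparℓ P.Lbℓ → ℤ} (inv : S.InvPM P.J₀ℓ P.Lℓ P.Lθℓ P.S₀ℓ P.Tℓ Pint J pv) :
    S.KSizes P.J₀ℓ J P.Lℓ P.Lθℓ P.S₀ℓ P.Tℓ t pv P.DmaxKℓ P.MmaxKℓ := by
  classical
  intro k hk τ hτ s₁ hs₁ _hodd
  have hPr : (0 : ℝ) ≤ P.PrVℓ := by linarith [P.one_le_PrVp]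
  have hτT : tauNorm τ ≤ P.Tℓ := by have := Nat.div_le_self P.Tℓ (2 ^ J); omega
  have hs4 : s₁ < 2 ^ (k + 1 + J) * P.S₀ℓ := by rw [← four_mul_kpts_rec P J k]; exact hs₁
  have hB0 : 0 ≤ P.DmaxKℓ k := (P.DmaxK_pos k).le
  refine ⟨S.toQ.flat.DclearJ (h := P.hparℓ) P.J₀ℓ J P.Lℓ P.Lθℓ s₁ τ, S.toQ.flat.DclearJ_pos _ _ _ _ _ _,
    ?_, S.exists_int_flatDclearJ_mul_coreSum P.J₀ℓ J P.Lℓ P.Lθℓ pv τ s₁, ?_⟩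
  · have := hy.DclearJ_le_pℓ hJ.le hk.le hτT hs4
    unfold PadicW80ParL.DmaxKℓ PadicW80ParL.Efacℓ; exact this
  · have hterm : ∀ u ∈ S.toQ.flat.box (h := P.hparℓ) (Lb := P.Lbℓ) P.Lℓ P.Lθℓ J,
        |(pv u : ℝ)| * |(S.toQ.qTerm P.J₀ℓ J u τ s₁ : ℝ)| ≤ P.PrVℓ * P.DmaxKℓ k := by
      intro u hu
      have hq : |(S.toQ.qTerm P.J₀ℓ J u τ s₁ : ℝ)| ≤ P.DmaxKℓ k := by
        rw [S.abs_cast_qTerm_eq_flat]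
        have := hy.abs_qTerm_le_pℓ hJ.le hk.le (u := u) hu hτT hs4
        unfold PadicW80ParL.DmaxKℓ PadicW80ParL.Efacℓ; exact this
      have hp : |(pv u : ℝ)| ≤ P.PrVℓ := le_trans (by exact_mod_cast inv.inv.bound u) hPint
      exact mul_le_mul hp hq (abs_nonneg _) hPr
    have hcard : ((S.toQ.flat.box (h := P.hparℓ) (Lb := P.Lbℓ) P.Lℓ P.Lθℓ J).card : ℝ) ≤ P.𝔅ℓ :=
      S.toQ.flat.card_box_le_𝔅_pℓ P J
    show |((S.toQ.coreSum P.J₀ℓ J _ pv τ s₁ : ℚ) : ℝ)| ≤ P.MmaxKℓ k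
    unfold SetupQ.coreSum PadicW80ParL.MmaxKℓ
    push_cast
    calc |∑ u ∈ S.toQ.flat.box (h := P.hparℓ) (Lb := P.Lbℓ) P.Lℓ P.Lθℓ J, (pv u : ℝ) * (S.toQ.qTerm P.J₀ℓ J u τ s₁ : ℝ)|
        ≤ ∑ u ∈ S.toQ.flat.box (h := P.hparℓ) (Lb := P.Lbℓ) P.Lℓ P.Lθℓ J, |(pv u : ℝ) * (S.toQ.qTerm P.J₀ℓ J u τ s₁ : ℝ)| :=
          abs_sum_le_sum_abs _ _
      _ ≤ ∑ u ∈ S.toQ.flat.box (h := P.hparℓ) (Lb := P.Lbℓ) P.Lℓ P.Lθℓ J, P.PrVℓ * P.DmaxKℓ k :=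
          sum_le_sum fun u hu => by rw [abs_mul]; exact hterm u hu
      _ = (S.toQ.flat.box (h := P.hparℓ) (Lb := P.Lbℓ) P.Lℓ P.Lθℓ J).card * (P.PrVℓ * P.DmaxKℓ k) := by
          rw [sum_const, nsmul_eq_mul]
      _ ≤ P.𝔅ℓ * (P.PrVℓ * P.DmaxKℓ k) := mul_le_mul_of_nonneg_right hcard (mul_nonneg hPr hB0)
      _ = P.𝔅ℓ * P.PrVℓ * P.DmaxKℓ k := by ring

/-- **Siegel's lemma on a class with the SHARP bound** `AmaxPM = 𝔔²¹E(2)` and the class price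
`Mcl = G`: integers `pv(u)` of level `0` on one class, `|pv(u)| ≤ ⌈#box₀ · AmaxPM⌉`. [folklore] -/
theorem siegel_of_hyp_pm (hMcl : P.Mcl = S.G) :
    S.Siegel (h := P.hparℓ) (Lb := P.Lbℓ) P.J₀ℓ P.Lℓ P.Lθℓ P.S₀ℓ P.Tℓ
      ⌈((S.toQ.flat.box (h := P.hparℓ) (Lb := P.Lbℓ) P.Lℓ P.Lθℓ 0).card : ℝ) * P.AmaxPMℓ⌉ := by
  classical
  have hS₀ : 1 ≤ P.S₀ℓ := le_trans (by norm_num) P.two_le_S₀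
  have hA : ∀ s, s < P.S₀ℓ → ∀ τ : Tau S.d, tauNorm τ < P.Tℓ →
      ∀ u ∈ S.toQ.flat.box (h := P.hparℓ) (Lb := P.Lbℓ) P.Lℓ P.Lθℓ 0,
      |((S.toQ.flat.Dclear (h := P.hparℓ) P.J₀ℓ P.Lℓ P.Lθℓ s τ : ℕ) : ℝ) * (S.toQ.qTerm P.J₀ℓ 0 u τ s : ℝ)| ≤
        P.AmaxPMℓ := by
    intro s hs τ hτ u hu
    rw [abs_mul, S.abs_cast_qTerm_eq_flat, ← abs_mul]
    exact hy.abs_Dclear_qTerm_le_pm hs hτ hu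
  -- the count with the class price: `2·G·#((range S₀) ×ˢ tauSet) ≤ #box₀`
  have hcount : 2 * S.G * ((range P.S₀ℓ) ×ˢ tauSet S.d P.Tℓ).card ≤
      (S.toQ.flat.box (h := P.hparℓ) (Lb := P.Lbℓ) P.Lℓ P.Lθℓ 0).card := by
    have hreal := PadicW80ParL.padic_siegel_count_real S.toQ.flat P
    rw [hMcl] at hreal
    rw [S.toQ.flat.card_box, card_product, card_range]
    simp only [pow_zero, Nat.div_one]
    have hprodL : (∏ j, (P.Lℓ j + 1)) * (P.Lθℓ + 1) = ∏ i, (P.Lallℓ i + 1) := by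
      rw [Fin.prod_univ_castSucc]
      simp only [PadicW80ParL.Lall_castSucc, PadicW80ParL.Lall_last]
    have key : ((2 * S.G * (P.S₀ℓ * (tauSet S.d P.Tℓ).card) : ℕ) : ℝ) ≤
        ((P.hparℓ * P.Lbℓ * ((∏ j, (P.Lℓ j + 1)) * (P.Lθℓ + 1)) : ℕ) : ℝ) := by
      rw [hprodL]; push_cast; linarith
    exact_mod_cast key
  exact S.siegel_class P.J₀ℓ P.Lℓ P.Lθℓ P.S₀ℓ P.Tℓ hS₀ P.one_le_T hcount P.one_le_AmaxPM hA

omit hy in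
/-- **The endgame, ± form, at the record** (`endgamePM_of_numbers` with p1's `endgame_numbers` and
`Lθ_lt_two_pow`). [folklore] -/
theorem endgamePM_of_params (P : PadicW80ParL S.d) (Pint : ℤ) :
    S.EndgamePM (h := P.hparℓ) (Lb := P.Lbℓ) P.J₀ℓ P.Lℓ P.Lθℓ P.S₀ℓ P.Tℓ Pint := by
  obtain ⟨h1, h2⟩ := P.endgame_numbers
  have hT' : (P.Tℓ / 2 ^ P.J₀ℓ - ∑ j, P.Lℓ j / 2 ^ P.J₀ℓ) + ∑ j, P.Lℓ j / 2 ^ P.J₀ℓ ≤ P.Tℓ / 2 ^ P.J₀ℓ := by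
    omega
  exact S.endgamePM_of_numbers (T' := P.Tℓ / 2 ^ P.J₀ℓ - ∑ j, P.Lℓ j / 2 ^ P.J₀ℓ) h2 P.Lθ_lt_two_pow hT'

/-! ### The integer coefficient bound `PintPM` -/

omit hy in
/-- The integer coefficient bound of Siegel's step on a class, sharp form: `⌈#box₀ · AmaxPM⌉`. [folklore] -/
def PintPM (S : TwistSetup p) (P : PadicW80ParL S.d) : ℤ :=
  ⌈((S.toQ.flat.box (h := P.hparℓ) (Lb := P.Lbℓ) P.Lℓ P.Lθℓ 0).card : ℝ) * P.AmaxPMℓ⌉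

omit hy in
/-- `PintPM ≤ PrVPM` (`#box₀ ≤ 𝔔`). [folklore] -/
theorem PintPM_le_PrVPM (S : TwistSetup p) (P : PadicW80ParL S.d) : (S.PintPM P : ℝ) ≤ P.PrVPMℓ := by
  unfold PintPM; exact S.toQ.flat.ceil_card_box_mul_AmaxPM_le P

omit hy in
/-- `PintPM ≤ PrV` (so the landed coarse k-step sizes apply). [folklore] -/
theorem PintPM_le_PrV (S : TwistSetup p) (P : PadicW80ParL S.d) : (S.PintPM P : ℝ) ≤ P.PrVℓ :=
  (S.PintPM_le_PrVPM P).trans P.PrVPM_le_PrV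

/-! ### The ± half step at the record -/

/-- **The ± half step at level `J < J₀` at p1's record**, from the signed Kummer condition and the
smallness `‖Λ₀‖_p ≤ e^{−U}`: p3's `halfStepPM_of_numerics` with `D(s,τ) = Dhalf♭(s,τ) ≤ DmaxHPM`,
`Mb(s,τ) = max(MmaxHPM, Σ_u P|rHalf(u)|) = MmaxHPM` on the relevant range, and the half-point inequality
at exponent `2^{d+2}` from the landed `halfstep_ineq_one/two` through `bhalf_le_budget_pm` and
`threshold_antitone`. [cite: Yu1990, §2.4 Lemmas 2.4–2.5] [cite: Waldschmidt1980, Lemma 3.7 (pp. 272–273)] -/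
theorem halfStepPM_of_hyp
    (hind : ∀ T' : Finset (Fin (S.d + 1)), T'.Nonempty →
      ¬ IsSquare (∏ i ∈ T', S.toQ.all i) ∧ ¬ IsSquare (-∏ i ∈ T', S.toQ.all i))
    (hℓp : P.ℓ = Real.log p) (hΛ : ‖S.Λ₀‖ ≤ Real.exp (-P.Uℓ)) {J : ℕ} (hJ : J < P.J₀ℓ) :
    S.HalfStepPM (h := P.hparℓ) (Lb := P.Lbℓ) P.J₀ℓ J P.Lℓ P.Lθℓ P.S₀ℓ P.Tℓ (P.tJℓ J) (S.PintPM P) := by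
  classical
  have hp0 : (0 : ℝ) < p := by exact_mod_cast (Fact.out : p.Prime).pos
  have hΛ' : ‖S.Λ₀‖ ≤ (p : ℝ)⁻¹ := by
    refine hΛ.trans ?_
    rw [← Real.exp_log hp0, ← Real.exp_neg, Real.exp_le_exp, ← hℓp]
    exact neg_le_neg P.ℓ_le_U
  have hroom : ∀ τ : Tau S.d, tauNorm τ < P.Tℓ / 2 ^ (J + 1) →
      tauNorm τ + P.tJℓ J ≤ P.Tℓ / 2 ^ J - S.d * P.tJℓ J := by
    intro τ hτ
    have h2 := P.room_half J
    have e1 : (S.d + 1) * P.tJℓ J = S.d * P.tJℓ J + P.tJℓ J := by ring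
    rw [e1] at h2
    omega
  have hH1 : 1 ≤ heightProd S.toQ.all := CW77.one_le_heightProd _
  have hH : heightProd S.toQ.all ≤ Real.exp ((∑ j, P.V j) + P.Vθ) := by
    have h1 := hy.heightProd_le
    rw [S.toQ.heightProd_flat_all, CW77.Setup.SizeHyp.sum_snoc] at h1
    exact h1
  have hHpos : 0 < heightProd S.toQ.all := by linarith
  -- the box and the per-`(s,τ)` data
  set box := S.toQ.flat.box (h := P.hparℓ) (Lb := P.Lbℓ) P.Lℓ P.Lθℓ J with hbox
  set D : ℕ → Tau S.d → ℕ := fun s τ => S.toQ.flat.Dhalf (h := P.hparℓ) P.J₀ℓ J P.Lℓ P.Lθℓ s τ with hDdef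
  have hD : ∀ s τ, 1 ≤ D s τ := fun s τ => S.toQ.flat.Dhalf_pos P.J₀ℓ J P.Lℓ P.Lθℓ s τ
  -- integrality of `Dhalf♭ · rHalf` on the box
  have hRex : ∀ s (τ : Tau S.d) (u : Idx S.d P.hparℓ P.Lbℓ), ∃ z : ℤ, u ∈ box →
      (D s τ : ℚ) * ((S.frame.qΔ P.J₀ℓ (J + 1) u τ.1 s * S.frame.qA u τ.2) * S.toQ.qEh u s) = z := by
    intro s τ u
    by_cases hu : u ∈ box
    · obtain ⟨z, hz⟩ := S.toQ.exists_int_Dhalf_mul_rHalf P.J₀ℓ J hu τ s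
      refine ⟨z, fun _ => ?_⟩
      rw [← hz]
      unfold SetupQ.rHalf
      simp only [hDdef]
    · exact ⟨0, fun h' => (hu h').elim⟩
  choose Rint hRint using hRex
  -- the size of the class sums over the whole box
  set Mb : ℕ → Tau S.d → ℝ := fun s τ => max P.MmaxHPMℓ
      (∑ u ∈ box, ((S.PintPM P : ℤ) : ℝ) *
        |((S.frame.qΔ P.J₀ℓ (J + 1) u τ.1 s * S.frame.qA u τ.2 * S.toQ.qEh u s : ℚ) : ℝ)|) with hMbdef
  have hMb : ∀ s τ, 1 ≤ Mb s τ := fun s τ => le_trans P.one_le_MmaxHPM (le_max_left _ _)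
  have hMbP : ∀ s (τ : Tau S.d), ∑ u ∈ box, ((S.PintPM P : ℤ) : ℝ) *
      |((S.frame.qΔ P.J₀ℓ (J + 1) u τ.1 s * S.frame.qA u τ.2 * S.toQ.qEh u s : ℚ) : ℝ)| ≤ Mb s τ :=
    fun s τ => le_max_right _ _
  -- on the relevant range the sum is `≤ MmaxHPM`, so `Mb = MmaxHPM`, and `D ≤ DmaxHPM`
  have hsum : ∀ s, s < 2 ^ (J + 1) * P.S₀ℓ → ∀ τ : Tau S.d, tauNorm τ ≤ P.Tℓ →
      ∑ u ∈ box, ((S.PintPM P : ℤ) : ℝ) *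
        |((S.frame.qΔ P.J₀ℓ (J + 1) u τ.1 s * S.frame.qA u τ.2 * S.toQ.qEh u s : ℚ) : ℝ)| ≤ P.MmaxHPMℓ := by
    intro s hs τ hτ
    refine S.toQ.flat.sum_mul_abs_le_MmaxHPM P J (fun u hu => ?_) (S.PintPM_le_PrVPM P)
    have e : ((S.frame.qΔ P.J₀ℓ (J + 1) u τ.1 s * S.frame.qA u τ.2 * S.toQ.qEh u s : ℚ) : ℝ) =
        ((S.toQ.rHalf P.J₀ℓ J u τ s : ℚ) : ℝ) := by
      unfold SetupQ.rHalf; rfl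
    rw [e, S.abs_cast_rHalf_eq_flat]
    exact hy.abs_rHalf_le_pm hJ hu hτ hs
  have hMbeq : ∀ s, s < 2 ^ (J + 1) * P.S₀ℓ → ∀ τ : Tau S.d, tauNorm τ ≤ P.Tℓ → Mb s τ = P.MmaxHPMℓ :=
    fun s hs τ hτ => max_eq_left (hsum s hs τ hτ)
  have hDle : ∀ s, s < 2 ^ (J + 1) * P.S₀ℓ → ∀ τ : Tau S.d, tauNorm τ ≤ P.Tℓ → (D s τ : ℝ) ≤ P.DmaxHPMℓ :=
    fun s hs τ hτ => hy.Dhalf_le_pm hJ hτ hs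
  -- the half-point inequality with the closed forms
  have hfin0 := S.hFinalHalfPM_of_log_ineq (h := P.hparℓ) (Lb := P.Lbℓ) J P.S₀ℓ (P.tJℓ J) hΛ
    P.DmaxHPM_pos P.MmaxHPM_pos
    (P.halfstep_ineq_one S.hp3 hℓp hJ (P.bhalf_le_budget_pm hH1 hH))
    (P.halfstep_ineq_two S.hp3 hℓp hJ (P.bhalf_le_budget_pm hH1 hH))
  refine S.halfStepPM_of_numerics hJ (P.one_le_tJ hJ) hΛ' hroom hind D hD Rint
    (fun s τ u hu => hRint s τ u hu) Mb hMb hMbP ?_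
  intro s hs hodd τ hτ
  have hτT : tauNorm τ ≤ P.Tℓ := by have := Nat.div_le_self P.Tℓ (2 ^ (J + 1)); omega
  rw [hMbeq s hs τ hτT]
  refine lt_of_lt_of_le hfin0 ?_
  have hD1 : (1 : ℝ) ≤ D s τ := by exact_mod_cast hD s τ
  exact PadicW80ParL.threshold_antitone hD1 (hDle s hs τ hτT) P.MmaxHPM_pos le_rfl hHpos
    (Nat.one_le_two_pow)

/-! ### The pack -/

/-- **The parameter pack of the ± machine at p1's record**, every input of `TwistSetup.main_pm`
discharged from the height link, the SIGNED Kummer condition, `ℓ = log p` and the class price `Mcl = G`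
(any twist order `G`). [folklore] -/
def paramPackPMOf
    (hind : ∀ T' : Finset (Fin (S.d + 1)), T'.Nonempty →
      ¬ IsSquare (∏ i ∈ T', S.toQ.all i) ∧ ¬ IsSquare (-∏ i ∈ T', S.toQ.all i))
    (hℓp : P.ℓ = Real.log p) (hMcl : P.Mcl = S.G) : S.ParamPackPM P.Uℓ where
  h := P.hparℓ
  Lb := P.Lbℓ
  J₀ := P.J₀ℓ
  L := P.Lℓ
  Lθ := P.Lθℓ
  S₀ := P.S₀ℓ
  T := P.Tℓ
  P := S.PintPM P
  t := P.tJℓ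
  Dmax := fun _ k => P.DmaxKℓ k
  Mmax := fun _ k => P.MmaxKℓ k
  hS₀ := P.even_S₀
  ht := fun _ hJ => P.one_le_tJ hJ
  htT := fun J _ => by have := P.tJ_mul_le J; nlinarith
  hUp := by rw [← hℓp]; exact P.ℓ_le_U
  hsz := fun J hJ pv inv => kSizes_of_hypPM hy hJ (P.tJℓ J) (S.PintPM_le_PrV P) inv
  hfin := fun hΛ J hJ =>
    S.kFinal_of_log_ineq J P.S₀ℓ (P.tJℓ J) (fun k => P.DmaxKℓ k) (fun k => P.MmaxKℓ k) hΛ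
      (fun k _ => ⟨P.DmaxK_pos k, P.MmaxK_pos k⟩)
      (fun k hk => P.kstep_ineq_one S.hp3 hℓp hJ hk (P.logDM_le_budget k))
      (fun k hk => P.kstep_ineq_two S.hp3 hℓp hJ hk (P.logDM_le_budget k))
  hhalf := fun hΛ J hJ => halfStepPM_of_hyp hy hind hℓp hΛ hJ
  hsiegel := S.siegelPM_of_siegel (siegel_of_hyp_pm hy hMcl)
  hend := endgamePM_of_params P _

/-- **`‖Λ₀‖_p > e^{−U}` at p1's record, ± machine** — all inputs of the twisted descent discharged. [folklore] -/
theorem norm_Λ₀_gt_pm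
    (hind : ∀ T' : Finset (Fin (S.d + 1)), T'.Nonempty →
      ¬ IsSquare (∏ i ∈ T', S.toQ.all i) ∧ ¬ IsSquare (-∏ i ∈ T', S.toQ.all i))
    (hℓp : P.ℓ = Real.log p) (hMcl : P.Mcl = S.G) : Real.exp (-P.Uℓ) < ‖S.Λ₀‖ :=
  not_le.mp (S.not_norm_Λ₀_le_of_paramPackPM (paramPackPMOf hy hind hℓp hMcl))

end TwistSetup

end Summit.ABC.StewartYu

end
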